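import Summits.CriticalPhenomena.PercolationContinuityZ3.Theorems.PercAnnulusCrossingHarrisSlackLattice
import Summits.CriticalPhenomena.PercolationContinuityZ3.Theorems.PercAnnulusCrossingOSSSBlock
import HarnessLib

/-!
# RSW3 lane (lead, gen 23): ANATOMY OF THE HARRIS SLACK, VII — Kesten's box crossings: two crossing directions of one block `{0..L} ⊆ ℤ^d`
# are correlated exactly through their jointly pivotal edges (every `d`, `L`, `p`)

builds on p205010 (kernel theorem, internal audit signed; external expert review pending) — NOT used in this file (every `d`, every `p`).

Cell `prim-rsw3` (LANE 3), lead seat, gen 23.  Support file (`--supports stmt-CriticalPhenomena-4575`); no definitions, no named facts,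
no sorries.  Part IV on the lane's basic events: Kesten's `i`-crossing `boxCross L i` of the block `{0..L}` (`BoxCrossingDefs`), read on the lattice
cube of `Λ(N) ⊇ {0..L}` through gen 19's event identity `boxCross L i = {H^i_0 ↔ H^i_{L_i} by an open block path}` (`sconn_hyperplanes_iff_mem_boxCross`)
and pivotality bridge.  For two directions `i, j` (or twice the same), every `d`, `N`, `p`:

* `real_setOf_sconn_hyperplanes_eq`, `real_inter_setOf_sconn_hyperplanes_eq`, `real_isPivotal_setOf_sconn_hyperplanes_eq` — the cube events
  and their pivotal events have the probabilities of `boxCross L i`, `boxCross L i ∩ boxCross L j`, `{z pivotal for boxCross L i}`;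
* **`boxCross_abs_cov_le_pivotal`** — `|P_p(boxCross L i ∩ boxCross L j) − P_p(boxCross L i)·P_p(boxCross L j)| ≤
  p(1−p)·Σ_{z ⊆ Λ(N)} √P_p(z piv boxCross L i)·√P_p(z piv boxCross L j)`: the crossings of a box in two directions are correlated only through
  the edges pivotal for both;
* **`boxCross_mul_le_inter`** — Harris for the pair (`P(LR)·P(TB) ≤ P(LR ∩ TB)`), by the noise route of parts I–II;
* **`boxCross_cov_ge_level_one_sub`** — the quantitative Harris inequality for the pair (`0 < p < 1`, `0 ≤ r ≤ p(1−p)`):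
  `P(A∩B) − P(A)P(B) ≥ r·p(1−p)·Σ_z P(z piv A)P(z piv B) − (r/(p(1−p)))²·√(P(A)√P(A))·√(P(B)√P(B))`.

References: H. Kesten, *Percolation Theory for Mathematicians* (1982) §3.3; G. Grimmett, *Percolation* (1999) Thm 2.4; M. Talagrand, Combinatorica
16 (1996) Thm 1.1; C. Garban, G. Pete, O. Schramm, Acta Math. 205 (2010) §1.
-/

noncomputable section

namespace Summit.CriticalPhenomena.PercolationContinuityZ3.Theorems.Crossing

open MeasureTheory Finset Function
open Literature.Probability.Percolation Literature.Probability.LatticeModels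
open Literature.Probability.ODonnellSaksSchrammServedio2005
open Literature.Probability.ODonnellSaksSchrammServedio2005.Strategy
open Literature.Probability.Percolation.GhostExploration Literature.Probability.Percolation.SeedExploration
open Literature.Probability.Percolation.OneArmOSSS Literature.Probability.Percolation.DCT16
open Summit.CriticalPhenomena.PercolationContinuityZ3.Theorems.SurfaceTension
open Summit.CriticalPhenomena.PercolationContinuityZ3.Theorems.CrossingRevealment
open Summit.CriticalPhenomena.PercolationContinuityZ3.Theorems.Crossing.Spectral

variable {d : ℕ} (L : Site d) (N : ℕ) (hLN : Finset.Icc (0 : Site d) L ⊆ box d N) (p : unitInterval)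

/-! ## §1 The cube events of the two crossings and their pivotal events -/

open Classical in
include hLN in
/-- The cube event `{H^i_0 ↔ H^i_{L_i}} ∘ toCube` has the probability of `boxCross L i`. [cite: Kesten1982, §3.3 Def. 1–3] -/
theorem real_setOf_sconn_hyperplanes_eq (i : Fin d) :
    (bondPercolation (zdGraph d) p).real {ω | SConn (fun a b : BoxV d N => if a.1 ∈ Icc 0 L ∧ b.1 ∈ Icc 0 L then latEdge d N a b else none)
        {v : BoxV d N | v.1 ∈ Icc 0 L ∧ v.1 i = 0} {v : BoxV d N | v.1 ∈ Icc 0 L ∧ v.1 i = L i} (toCube N ω)}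
      = (bondPercolation (zdGraph d) p).real (boxCross L i) :=
  real_congr_of_forall_subset_edgeSet (zdGraph d) p fun _ hω => sconn_hyperplanes_iff_mem_boxCross L i N hLN hω

open Classical in
include hLN in
/-- The intersection of two cube crossing events has the probability of `boxCross L i ∩ boxCross L j`. [cite: Kesten1982, §3.3 Def. 1–3] -/
theorem real_inter_setOf_sconn_hyperplanes_eq (i j : Fin d) :
    (bondPercolation (zdGraph d) p).real
        ({ω | SConn (fun a b : BoxV d N => if a.1 ∈ Icc 0 L ∧ b.1 ∈ Icc 0 L then latEdge d N a b else none)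
            {v : BoxV d N | v.1 ∈ Icc 0 L ∧ v.1 i = 0} {v : BoxV d N | v.1 ∈ Icc 0 L ∧ v.1 i = L i} (toCube N ω)}
          ∩ {ω | SConn (fun a b : BoxV d N => if a.1 ∈ Icc 0 L ∧ b.1 ∈ Icc 0 L then latEdge d N a b else none)
            {v : BoxV d N | v.1 ∈ Icc 0 L ∧ v.1 j = 0} {v : BoxV d N | v.1 ∈ Icc 0 L ∧ v.1 j = L j} (toCube N ω)})
      = (bondPercolation (zdGraph d) p).real (boxCross L i ∩ boxCross L j) :=
  real_congr_of_forall_subset_edgeSet (zdGraph d) p fun _ hω => by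
    simp only [Set.mem_inter_iff, Set.mem_setOf_eq]
    rw [sconn_hyperplanes_iff_mem_boxCross L i N hLN hω, sconn_hyperplanes_iff_mem_boxCross L j N hLN hω]

open Classical in
include hLN in
/-- The pivotal events agree too: for every pair `z`, `P_p(z ∈ E(ℤ^d), z pivotal for the cube event) = P_p(z ∈ E(ℤ^d), z pivotal for boxCross L i)`
(lattice configurations stay lattice configurations under `insert z` / `∖ {z}` for a lattice edge `z`). [cite: RussoZW1981, §4 Lemma 3] -/
theorem real_isPivotal_setOf_sconn_hyperplanes_eq (i : Fin d) (z : Sym2 (Site d)) :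
    (bondPercolation (zdGraph d) p).real {ω | z ∈ (zdGraph d).edgeSet ∧ IsPivotal {ω | SConn
        (fun a b : BoxV d N => if a.1 ∈ Icc 0 L ∧ b.1 ∈ Icc 0 L then latEdge d N a b else none)
        {v : BoxV d N | v.1 ∈ Icc 0 L ∧ v.1 i = 0} {v : BoxV d N | v.1 ∈ Icc 0 L ∧ v.1 i = L i} (toCube N ω)} z ω}
      = (bondPercolation (zdGraph d) p).real {ω | z ∈ (zdGraph d).edgeSet ∧ IsPivotal (boxCross L i) z ω} := by
  refine real_congr_of_forall_subset_edgeSet (zdGraph d) p fun ω hω => ?_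
  simp only [Set.mem_setOf_eq]
  by_cases hz : z ∈ (zdGraph d).edgeSet
  · have h1 : insert z ω ⊆ (zdGraph d).edgeSet := Set.insert_subset hz hω
    have h2 : ω \ {z} ⊆ (zdGraph d).edgeSet := fun x hx => hω hx.1
    simp only [hz, true_and, IsPivotal, Set.mem_setOf_eq]
    rw [sconn_hyperplanes_iff_mem_boxCross L i N hLN h1, sconn_hyperplanes_iff_mem_boxCross L i N hLN h2]
  · simp [hz]

/-! ## §2 Two crossing directions of one block -/

open Classical in
include hLN in
/-- **THE CROSSINGS OF A BOX IN TWO DIRECTIONS ARE CORRELATED ONLY THROUGH THEIR JOINTLY PIVOTAL EDGES** (every `d`, `{0..L} ⊆ Λ(N)`, `p`,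
directions `i, j`): `|P_p(boxCross L i ∩ boxCross L j) − P_p(boxCross L i)·P_p(boxCross L j)| ≤
p(1−p)·Σ_{z ⊆ Λ(N)} √P_p(z ∈ E(ℤ^d), z piv boxCross L i)·√P_p(z ∈ E(ℤ^d), z piv boxCross L j)` (part IV's `lattice_abs_cov_le_pivotal` for the two
cube events, which are increasing). [cite: Talagrand1996, §1] [cite: GarbanPeteSchramm2010, §1] [cite: Kesten1982, §3.3] -/
theorem boxCross_abs_cov_le_pivotal (i j : Fin d) :
    |(bondPercolation (zdGraph d) p).real (boxCross L i ∩ boxCross L j)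
        - (bondPercolation (zdGraph d) p).real (boxCross L i) * (bondPercolation (zdGraph d) p).real (boxCross L j)|
      ≤ (p : ℝ) * (1 - p) * ∑ z ∈ (box d N).sym2,
          Real.sqrt ((bondPercolation (zdGraph d) p).real {ω | z ∈ (zdGraph d).edgeSet ∧ IsPivotal (boxCross L i) z ω})
            * Real.sqrt ((bondPercolation (zdGraph d) p).real {ω | z ∈ (zdGraph d).edgeSet ∧ IsPivotal (boxCross L j) z ω}) := by
  have h := lattice_abs_cov_le_pivotal N p
    (fun x => SConn (fun a b : BoxV d N => if a.1 ∈ Icc 0 L ∧ b.1 ∈ Icc 0 L then latEdge d N a b else none)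
        {v : BoxV d N | v.1 ∈ Icc 0 L ∧ v.1 i = 0} {v : BoxV d N | v.1 ∈ Icc 0 L ∧ v.1 i = L i} x)
    (fun x => SConn (fun a b : BoxV d N => if a.1 ∈ Icc 0 L ∧ b.1 ∈ Icc 0 L then latEdge d N a b else none)
        {v : BoxV d N | v.1 ∈ Icc 0 L ∧ v.1 j = 0} {v : BoxV d N | v.1 ∈ Icc 0 L ∧ v.1 j = L j} x)
    (fun e x hx => sconn_block_mono L N (fun e' he' => by
      by_cases hee : e' = e
      · subst hee; simp
      · rwa [update_of_ne hee] at he' ⊢) hx)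
    (fun e x hx => sconn_block_mono L N (fun e' he' => by
      by_cases hee : e' = e
      · subst hee; simp
      · rwa [update_of_ne hee] at he' ⊢) hx)
  rw [real_inter_setOf_sconn_hyperplanes_eq L N hLN p i j, real_setOf_sconn_hyperplanes_eq L N hLN p i,
    real_setOf_sconn_hyperplanes_eq L N hLN p j] at h
  simp only [real_isPivotal_setOf_sconn_hyperplanes_eq L N hLN p] at h
  exact h

open Classical in
include hLN in
/-- **HARRIS FOR TWO CROSSING DIRECTIONS, by the noise route**: `P_p(boxCross L i)·P_p(boxCross L j) ≤ P_p(boxCross L i ∩ boxCross L j)` (the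
slack being `p(1−p)·∫_0^1 E_p[#edges pivotal for the i-crossing in ω and for the j-crossing in ω^ε] dε`, part IV `lattice_cov_eq_integral`).
[cite: Harris1960, Lemma 4.1] [cite: Kesten1982, §3.3 (crossing events are increasing)] -/
theorem boxCross_mul_le_inter (i j : Fin d) :
    (bondPercolation (zdGraph d) p).real (boxCross L i) * (bondPercolation (zdGraph d) p).real (boxCross L j)
      ≤ (bondPercolation (zdGraph d) p).real (boxCross L i ∩ boxCross L j) := by
  have h := harris_of_monotone (boxBias d N p) (boxBias_nonneg N p.2.1) (boxBias_le_one N p.2.2)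
    (gcross (fun a b : BoxV d N => if a.1 ∈ Icc 0 L ∧ b.1 ∈ Icc 0 L then latEdge d N a b else none)
        {v : BoxV d N | v.1 ∈ Icc 0 L ∧ v.1 i = 0} {v : BoxV d N | v.1 ∈ Icc 0 L ∧ v.1 i = L i})
    (gcross (fun a b : BoxV d N => if a.1 ∈ Icc 0 L ∧ b.1 ∈ Icc 0 L then latEdge d N a b else none)
        {v : BoxV d N | v.1 ∈ Icc 0 L ∧ v.1 j = 0} {v : BoxV d N | v.1 ∈ Icc 0 L ∧ v.1 j = L j})
    (fun e x => gcross_update_false_le _ _ x e) (fun e x => gcross_update_false_le _ _ x e)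
  rw [sum_wt_gcross_hyperplanes_eq L i N hLN p, sum_wt_gcross_hyperplanes_eq L j N hLN p] at h
  refine h.trans (le_of_eq ?_)
  rw [← real_inter_setOf_sconn_hyperplanes_eq L N hLN p i j, real_inter_setOf_toCube N p]
  refine Finset.sum_congr rfl fun x _ => ?_
  unfold gcross
  rfl

open Classical in
include hLN in
/-- **THE QUANTITATIVE HARRIS INEQUALITY FOR TWO CROSSING DIRECTIONS** (every `d`, `{0..L} ⊆ Λ(N)`, `0 < p < 1`, `0 ≤ r ≤ p(1−p)`; `A = boxCross L i`,
`B = boxCross L j`, `I_z(·) = P_p(z ∈ E(ℤ^d), z pivotal)`):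
`P_p(A ∩ B) − P_p(A)P_p(B) ≥ r·p(1−p)·Σ_{z ⊆ Λ(N)} I_z(A)·I_z(B) − (r/(p(1−p)))²·√(P(A)√P(A))·√(P(B)√P(B))` (part IV `lattice_cov_ge_level_one_sub`).
[cite: Talagrand1996, Thm 1.1] [cite: KellerMosselSen2014, Thm 1.2] -/
theorem boxCross_cov_ge_level_one_sub (i j : Fin d) (hp0 : 0 < (p : ℝ)) (hp1 : (p : ℝ) < 1) {r : ℝ} (hr0 : 0 ≤ r)
    (hr : r ≤ (p : ℝ) * (1 - p)) :
    r * ((p : ℝ) * (1 - p)) * ∑ z ∈ (box d N).sym2,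
          (bondPercolation (zdGraph d) p).real {ω | z ∈ (zdGraph d).edgeSet ∧ IsPivotal (boxCross L i) z ω}
            * (bondPercolation (zdGraph d) p).real {ω | z ∈ (zdGraph d).edgeSet ∧ IsPivotal (boxCross L j) z ω}
        - (r / ((p : ℝ) * (1 - p))) ^ 2
          * (Real.sqrt ((bondPercolation (zdGraph d) p).real (boxCross L i)
              * Real.sqrt ((bondPercolation (zdGraph d) p).real (boxCross L i)))
            * Real.sqrt ((bondPercolation (zdGraph d) p).real (boxCross L j)
              * Real.sqrt ((bondPercolation (zdGraph d) p).real (boxCross L j))))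
      ≤ (bondPercolation (zdGraph d) p).real (boxCross L i ∩ boxCross L j)
        - (bondPercolation (zdGraph d) p).real (boxCross L i) * (bondPercolation (zdGraph d) p).real (boxCross L j) := by
  have h := lattice_cov_ge_level_one_sub N p
    (fun x => SConn (fun a b : BoxV d N => if a.1 ∈ Icc 0 L ∧ b.1 ∈ Icc 0 L then latEdge d N a b else none)
        {v : BoxV d N | v.1 ∈ Icc 0 L ∧ v.1 i = 0} {v : BoxV d N | v.1 ∈ Icc 0 L ∧ v.1 i = L i} x)
    (fun x => SConn (fun a b : BoxV d N => if a.1 ∈ Icc 0 L ∧ b.1 ∈ Icc 0 L then latEdge d N a b else none)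
        {v : BoxV d N | v.1 ∈ Icc 0 L ∧ v.1 j = 0} {v : BoxV d N | v.1 ∈ Icc 0 L ∧ v.1 j = L j} x)
    (fun e x hx => sconn_block_mono L N (fun e' he' => by
      by_cases hee : e' = e
      · subst hee; simp
      · rwa [update_of_ne hee] at he' ⊢) hx)
    (fun e x hx => sconn_block_mono L N (fun e' he' => by
      by_cases hee : e' = e
      · subst hee; simp
      · rwa [update_of_ne hee] at he' ⊢) hx)
    hp0 hp1 hr0 hr
  rw [real_inter_setOf_sconn_hyperplanes_eq L N hLN p i j, real_setOf_sconn_hyperplanes_eq L N hLN p i,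
    real_setOf_sconn_hyperplanes_eq L N hLN p j] at h
  simp only [real_isPivotal_setOf_sconn_hyperplanes_eq L N hLN p] at h
  exact h

end Summit.CriticalPhenomena.PercolationContinuityZ3.Theorems.Crossing

end
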